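import Mathlib
import Summits.ValiantsHypothesis.ValiantsHypothesis.Theses.ScaledPencil
import Summits.ValiantsHypothesis.ValiantsHypothesis.Theorems.ScaledPencilScaledSameSizeFibre

/-!
# `ScaledPencil.ScaledSameSize` (stmt-ValiantsHypothesis-5320): every determinantal pencil for
# `per_n` has an operator-scaled, torus-balanced pencil of the same size in its closed fibre

Route `ScaledPencil`, support item `ScaledSameSize` (analytic half of the normal form).  If
`det(Λ + Σ_v x_v L_v) = per_n` for complex `m × m` matrices `Λ, L_v` (`v : Fin n × Fin n`), then
there are `Λ', L'_v` of the same size with the same determinant and ONE constant `α > 0` such that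
`Λ'Λ'ᴴ + Σ L'_v L'_vᴴ = α I = Λ'ᴴΛ' + Σ L'_vᴴ L'_v` and `Σ_j ‖L'_(i,j)‖² = α = Σ_i ‖L'_(i,j)‖²`
for all `i, j`.

Proof (Kempf–Ness first-order condition, done by hand).  By the helper file
`ScaledPencilScaledSameSizeFibre` the fibre `F = {(Λ, L) : det(Λ + Σ x_v L_v) = per_n}` is
closed, the coercive `N(Λ, L) = ‖Λ‖_F² + Σ_v ‖L_v‖_F²` attains its minimum on `F` at some `w`,
and at `w` the left Gram matrix `A = ΛΛᴴ + Σ L_v L_vᴴ` is diagonal with every diagonal entry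
equal to every row sum `r_i = Σ_j ‖L_(i,j)‖²` (`offdiag_eq_zero`, `diag_eq_row`).  Here the
mirrored configuration `(Λᵀ, (L_(j,i))ᵀ)` is shown to be a minimiser as well (the permanent is
invariant under transposing the variable matrix, `mirror_min`), which gives the right Gram matrix
`B = ΛᴴΛ + Σ L_vᴴ L_v` and the column sums; the common value `α` of row and column sums is forced
by `Σ_i r_i = Σ_j c_j`, and `α > 0`, `m ≥ 1` come from `per_n ∉ {0, 1}` for `n ≥ 1`
(`scaled_of_pos`).  The case `n = 0` (`per_0 = 1`) is witnessed by `Λ' = 1` (`scaled_of_zero`).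
The closing theorem is `Summit.ValiantsHypothesis.Theorems.scaledSameSize_proof`.
-/

noncomputable section

namespace Summit.ValiantsHypothesis.Theorems.ScaledSameSize

open Matrix MvPolynomial Finset
open Literature.Computability.AlgebraicComplexity

variable {n m : ℕ}

/-! ## The mirror configuration `o ↦ (w (o.map swap))ᵀ` -/

/-- Reindexing a sum over `Option (Fin n × Fin n)` along `Option.map Prod.swap`. -/
theorem sum_option_swap {M : Type*} [AddCommMonoid M] (f : Option (Fin n × Fin n) → M) :
    ∑ o : Option (Fin n × Fin n), f (o.map Prod.swap) = ∑ o, f o :=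
  Equiv.sum_comp (Equiv.optionCongr (Equiv.prodComm (Fin n) (Fin n))) f

/-- The mirror of a fibre point is a fibre point (the permanent is invariant under transposing the
variable matrix, and `det Mᵀ = det M`). -/
theorem mirror_mem {w w' : Option (Fin n × Fin n) → Matrix (Fin m) (Fin m) ℂ}
    (hw : ∀ x : Fin n × Fin n → ℂ,
      (w none + ∑ v, x v • w (some v)).det = MvPolynomial.eval x (perPoly (Fin n) ℂ))
    (h : ∀ o, w' o = (w (o.map Prod.swap))ᵀ) :
    ∀ x : Fin n × Fin n → ℂ,
      (w' none + ∑ v, x v • w' (some v)).det = MvPolynomial.eval x (perPoly (Fin n) ℂ) := by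
  intro x
  have hsum : ∑ v, x v • w' (some v) = ∑ u, x u.swap • (w (some u))ᵀ := by
    rw [← Equiv.sum_comp (Equiv.prodComm (Fin n) (Fin n)) (fun u => x u.swap • (w (some u))ᵀ)]
    refine Finset.sum_congr rfl fun v _ => ?_
    simp [h]
  have key : w' none + ∑ v, x v • w' (some v) = (w none + ∑ u, x u.swap • w (some u))ᵀ := by
    rw [hsum, h none, Matrix.transpose_add, Matrix.transpose_sum]
    simp only [Option.map_none, Matrix.transpose_smul]
  rw [key, Matrix.det_transpose, hw (fun v => x v.swap), eval_perPoly_swap]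

/-- The mirror has the same norm. -/
theorem mirror_nrm {w w' : Option (Fin n × Fin n) → Matrix (Fin m) (Fin m) ℂ}
    (h : ∀ o, w' o = (w (o.map Prod.swap))ᵀ) :
    ∑ o, ∑ a, ∑ b, ‖w' o a b‖ ^ 2 = ∑ o, ∑ a, ∑ b, ‖w o a b‖ ^ 2 := by
  rw [← sum_option_swap (fun o => ∑ a, ∑ b, ‖w o a b‖ ^ 2)]
  refine Finset.sum_congr rfl fun o _ => ?_
  rw [h o, Finset.sum_comm]
  rfl

/-- The mirror of a norm minimiser of the fibre is a norm minimiser of the fibre. -/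
theorem mirror_min {w w' : Option (Fin n × Fin n) → Matrix (Fin m) (Fin m) ℂ}
    (hmin : ∀ w'' : Option (Fin n × Fin n) → Matrix (Fin m) (Fin m) ℂ,
      (∀ x : Fin n × Fin n → ℂ,
        (w'' none + ∑ v, x v • w'' (some v)).det = MvPolynomial.eval x (perPoly (Fin n) ℂ)) →
      ∑ o, ∑ a, ∑ b, ‖w o a b‖ ^ 2 ≤ ∑ o, ∑ a, ∑ b, ‖w'' o a b‖ ^ 2)
    (h : ∀ o, w' o = (w (o.map Prod.swap))ᵀ) :
    ∀ w'' : Option (Fin n × Fin n) → Matrix (Fin m) (Fin m) ℂ,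
      (∀ x : Fin n × Fin n → ℂ,
        (w'' none + ∑ v, x v • w'' (some v)).det = MvPolynomial.eval x (perPoly (Fin n) ℂ)) →
      ∑ o, ∑ a, ∑ b, ‖w' o a b‖ ^ 2 ≤ ∑ o, ∑ a, ∑ b, ‖w'' o a b‖ ^ 2 := by
  intro w'' hw''
  set wt : Option (Fin n × Fin n) → Matrix (Fin m) (Fin m) ℂ :=
    fun o => (w'' (o.map Prod.swap))ᵀ with hwt
  have hwto : ∀ o, wt o = (w'' (o.map Prod.swap))ᵀ := fun _ => rfl
  have hmem : ∀ x : Fin n × Fin n → ℂ,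
      (wt none + ∑ v, x v • wt (some v)).det = MvPolynomial.eval x (perPoly (Fin n) ℂ) :=
    mirror_mem hw'' hwto
  calc ∑ o, ∑ a, ∑ b, ‖w' o a b‖ ^ 2 = ∑ o, ∑ a, ∑ b, ‖w o a b‖ ^ 2 := mirror_nrm h
    _ ≤ ∑ o, ∑ a, ∑ b, ‖wt o a b‖ ^ 2 := hmin _ hmem
    _ = ∑ o, ∑ a, ∑ b, ‖w'' o a b‖ ^ 2 := mirror_nrm hwto

/-! ## From entry identities to the matrix identities -/

/-- `ΛΛᴴ + Σ_v L_v L_vᴴ = α • 1` from its entries. -/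
theorem left_gram_eq {w : Option (Fin n × Fin n) → Matrix (Fin m) (Fin m) ℂ} {α : ℝ}
    (hdiag : ∀ k, ∑ o, ∑ b, ‖w o k b‖ ^ 2 = α)
    (hoff : ∀ k l, k ≠ l → ∑ o, ∑ b, w o l b * (starRingEnd ℂ) (w o k b) = 0) :
    w none * (w none)ᴴ + ∑ v, w (some v) * (w (some v))ᴴ =
      (α : ℂ) • (1 : Matrix (Fin m) (Fin m) ℂ) := by
  ext k l
  have hL : (w none * (w none)ᴴ + ∑ v, w (some v) * (w (some v))ᴴ) k l =
      ∑ o, ∑ b, w o k b * (starRingEnd ℂ) (w o l b) := by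
    rw [Fintype.sum_option]
    simp only [Matrix.add_apply, Matrix.sum_apply, Matrix.mul_apply, conjTranspose_apply,
      starRingEnd_apply]
  rw [hL, Matrix.smul_apply, Matrix.one_apply, smul_eq_mul, mul_ite, mul_one, mul_zero]
  by_cases hkl : k = l
  · subst hkl
    rw [if_pos rfl, ← hdiag k]
    push_cast
    refine Finset.sum_congr rfl fun o _ => Finset.sum_congr rfl fun b _ => ?_
    rw [Complex.mul_conj, Complex.normSq_eq_norm_sq]
    push_cast
    rfl
  · rw [if_neg hkl]
    exact hoff l k (Ne.symm hkl)

/-- `ΛᴴΛ + Σ_v L_vᴴ L_v = α • 1` from its entries. -/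
theorem right_gram_eq {w : Option (Fin n × Fin n) → Matrix (Fin m) (Fin m) ℂ} {α : ℝ}
    (hdiag : ∀ k, ∑ o, ∑ a, ‖w o a k‖ ^ 2 = α)
    (hoff : ∀ k l, k ≠ l → ∑ o, ∑ a, w o a l * (starRingEnd ℂ) (w o a k) = 0) :
    (w none)ᴴ * w none + ∑ v, (w (some v))ᴴ * w (some v) =
      (α : ℂ) • (1 : Matrix (Fin m) (Fin m) ℂ) := by
  ext k l
  have hL : ((w none)ᴴ * w none + ∑ v, (w (some v))ᴴ * w (some v)) k l =
      ∑ o, ∑ a, w o a l * (starRingEnd ℂ) (w o a k) := by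
    rw [Fintype.sum_option]
    simp only [Matrix.add_apply, Matrix.sum_apply, Matrix.mul_apply, conjTranspose_apply,
      starRingEnd_apply, mul_comm]
  rw [hL, Matrix.smul_apply, Matrix.one_apply, smul_eq_mul, mul_ite, mul_one, mul_zero]
  by_cases hkl : k = l
  · subst hkl
    rw [if_pos rfl, ← hdiag k]
    push_cast
    refine Finset.sum_congr rfl fun o _ => Finset.sum_congr rfl fun a _ => ?_
    rw [Complex.mul_conj, Complex.normSq_eq_norm_sq]
    push_cast
    rfl
  · rw [if_neg hkl]
    exact hoff k l hkl

/-! ## The theorem -/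

/-- The case `n ≥ 1`: a pencil computing `per_n` has a scaled, balanced pencil of the same size in
its fibre (the norm minimiser). -/
theorem scaled_of_pos (hn : 0 < n) (Λ : Matrix (Fin m) (Fin m) ℂ)
    (L : Fin n × Fin n → Matrix (Fin m) (Fin m) ℂ)
    (hdet : (Matrix.of fun a b => MvPolynomial.C (Λ a b) +
        ∑ v : Fin n × Fin n, MvPolynomial.C (L v a b) * MvPolynomial.X v).det =
          perPoly (Fin n) ℂ) :
    ∃ (Λ' : Matrix (Fin m) (Fin m) ℂ) (L' : Fin n × Fin n → Matrix (Fin m) (Fin m) ℂ),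
      (Matrix.of fun a b => MvPolynomial.C (Λ' a b) +
          ∑ v : Fin n × Fin n, MvPolynomial.C (L' v a b) * MvPolynomial.X v).det =
        perPoly (Fin n) ℂ ∧
      (∃ α : ℝ, 0 < α ∧
        Λ' * Λ'.conjTranspose + ∑ v, L' v * (L' v).conjTranspose =
          (α : ℂ) • (1 : Matrix (Fin m) (Fin m) ℂ) ∧
        Λ'.conjTranspose * Λ' + ∑ v, (L' v).conjTranspose * L' v =
          (α : ℂ) • (1 : Matrix (Fin m) (Fin m) ℂ) ∧
        (∀ i : Fin n, ∑ j : Fin n, ∑ a, ∑ b, ‖L' (i, j) a b‖ ^ 2 = α) ∧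
        (∀ j : Fin n, ∑ i : Fin n, ∑ a, ∑ b, ‖L' (i, j) a b‖ ^ 2 = α)) := by
  -- the given pencil as a configuration, and a norm minimiser of the fibre
  set w₀ : Option (Fin n × Fin n) → Matrix (Fin m) (Fin m) ℂ := fun o => Option.elim o Λ L
    with hw₀
  have h₀ : ∀ x : Fin n × Fin n → ℂ,
      (w₀ none + ∑ v, x v • w₀ (some v)).det = MvPolynomial.eval x (perPoly (Fin n) ℂ) :=
    (det_pencil_eq_iff Λ L).mp hdet
  obtain ⟨w, hw, hmin⟩ := exists_min_nrm w₀ h₀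
  -- `m ≥ 1` since `per_n(0) = 0 ≠ 1 = det` of the empty matrix
  have hm : 0 < m := by
    rcases Nat.eq_zero_or_pos m with hm0 | hm
    · exfalso
      subst hm0
      have := hw (fun _ => 0)
      rw [eval_zero_perPoly hn, Matrix.det_isEmpty] at this
      exact one_ne_zero this
    · exact hm
  haveI : Nonempty (Fin m) := ⟨⟨0, hm⟩⟩
  set i₀ : Fin n := ⟨0, hn⟩ with hi₀
  set k₀ : Fin m := ⟨0, hm⟩ with hk₀
  set α : ℝ := ∑ j, ∑ a, ∑ b, ‖w (some (i₀, j)) a b‖ ^ 2 with hα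
  -- the mirror minimiser
  set wm : Option (Fin n × Fin n) → Matrix (Fin m) (Fin m) ℂ :=
    fun o => (w (o.map Prod.swap))ᵀ with hwm
  have hwmo : ∀ o, wm o = (w (o.map Prod.swap))ᵀ := fun _ => rfl
  have hwm_mem : ∀ x : Fin n × Fin n → ℂ,
      (wm none + ∑ v, x v • wm (some v)).det = MvPolynomial.eval x (perPoly (Fin n) ℂ) :=
    mirror_mem hw hwmo
  have hwm_min := mirror_min hmin hwmo
  -- left identities
  have hdiagA : ∀ k, ∑ o, ∑ b, ‖w o k b‖ ^ 2 = α := fun k => diag_eq_row hw hmin k i₀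
  have hrow : ∀ i, ∑ j, ∑ a, ∑ b, ‖w (some (i, j)) a b‖ ^ 2 = α := fun i => by
    rw [← diag_eq_row hw hmin k₀ i, hdiagA k₀]
  have hoffA : ∀ k l, k ≠ l → ∑ o, ∑ b, w o l b * (starRingEnd ℂ) (w o k b) = 0 :=
    fun k l hkl => offdiag_eq_zero hw hmin hkl
  -- right identities, through the mirror
  have hcolmass : ∀ (k : Fin m) (j₀ : Fin n),
      ∑ o, ∑ a, ‖w o a k‖ ^ 2 = ∑ i, ∑ a, ∑ b, ‖w (some (i, j₀)) a b‖ ^ 2 := by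
    intro k j₀
    have h1 := diag_eq_row hwm_mem hwm_min k j₀
    simp only [hwmo, transpose_apply, Option.map_some, Prod.swap_prod_mk] at h1
    rw [sum_option_swap (fun o => ∑ b, ‖w o b k‖ ^ 2)] at h1
    rw [h1]
    exact Finset.sum_congr rfl fun i _ => Finset.sum_comm
  have hoffB : ∀ k l, k ≠ l → ∑ o, ∑ a, w o a l * (starRingEnd ℂ) (w o a k) = 0 := by
    intro k l hkl
    have h1 := offdiag_eq_zero hwm_mem hwm_min hkl
    simp only [hwmo, transpose_apply] at h1
    rwa [sum_option_swap (fun o => ∑ b, w o b l * (starRingEnd ℂ) (w o b k))] at h1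
  have hcol : ∀ j, ∑ i, ∑ a, ∑ b, ‖w (some (i, j)) a b‖ ^ 2 = α := by
    intro j
    have hc : ∀ j', ∑ i, ∑ a, ∑ b, ‖w (some (i, j')) a b‖ ^ 2 = ∑ o, ∑ a, ‖w o a k₀‖ ^ 2 :=
      fun j' => (hcolmass k₀ j').symm
    have htot : ∑ j', ∑ i, ∑ a, ∑ b, ‖w (some (i, j')) a b‖ ^ 2 =
        ∑ i, ∑ j', ∑ a, ∑ b, ‖w (some (i, j')) a b‖ ^ 2 := Finset.sum_comm
    simp only [hc, hrow, Finset.sum_const, Finset.card_univ, Fintype.card_fin, nsmul_eq_mul]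
      at htot
    have hn' : (n : ℝ) ≠ 0 := by exact_mod_cast hn.ne'
    rw [hc, mul_left_cancel₀ hn' htot]
  have hdiagB : ∀ k, ∑ o, ∑ a, ‖w o a k‖ ^ 2 = α := fun k => by rw [hcolmass k i₀, hcol i₀]
  -- positivity of `α`: otherwise `w = 0`, `det = 0 ≠ n! = per_n(1, …, 1)`
  have hαpos : 0 < α := by
    rcases (show (0 : ℝ) ≤ α by positivity).eq_or_lt with h0 | hpos
    · exfalso
      have hzero : ∀ o a b, w o a b = 0 := by
        intro o a b
        have h1 := hdiagA a
        rw [← h0, Finset.sum_eq_zero_iff_of_nonneg (fun _ _ => by positivity)] at h1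
        have h2 := h1 o (Finset.mem_univ _)
        rw [Finset.sum_eq_zero_iff_of_nonneg (fun _ _ => by positivity)] at h2
        have h3 := h2 b (Finset.mem_univ _)
        exact norm_eq_zero.mp (pow_eq_zero_iff two_ne_zero |>.mp h3)
      have := hw (fun _ => 1)
      have hmat : w none + ∑ v, (1 : ℂ) • w (some v) = 0 := by
        ext a b
        simp [Matrix.sum_apply, hzero]
      rw [hmat, Matrix.det_zero] at this
      exact eval_one_perPoly_ne_zero this.symm
    · exact hpos
  -- conclude
  exact ⟨w none, fun v => w (some v), (det_pencil_eq_iff _ _).mpr hw, α, hαpos,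
    left_gram_eq hdiagA hoffA, right_gram_eq hdiagB hoffB, hrow, hcol⟩

/-- The case `n = 0`: `per_0 = 1` and `Λ' = 1`, `α = 1` is a scaled pencil of any size. -/
theorem scaled_of_zero (L : Fin 0 × Fin 0 → Matrix (Fin m) (Fin m) ℂ) :
    ∃ (Λ' : Matrix (Fin m) (Fin m) ℂ) (L' : Fin 0 × Fin 0 → Matrix (Fin m) (Fin m) ℂ),
      (Matrix.of fun a b => MvPolynomial.C (Λ' a b) +
          ∑ v : Fin 0 × Fin 0, MvPolynomial.C (L' v a b) * MvPolynomial.X v).det =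
        perPoly (Fin 0) ℂ ∧
      (∃ α : ℝ, 0 < α ∧
        Λ' * Λ'.conjTranspose + ∑ v, L' v * (L' v).conjTranspose =
          (α : ℂ) • (1 : Matrix (Fin m) (Fin m) ℂ) ∧
        Λ'.conjTranspose * Λ' + ∑ v, (L' v).conjTranspose * L' v =
          (α : ℂ) • (1 : Matrix (Fin m) (Fin m) ℂ) ∧
        (∀ i : Fin 0, ∑ j : Fin 0, ∑ a, ∑ b, ‖L' (i, j) a b‖ ^ 2 = α) ∧
        (∀ j : Fin 0, ∑ i : Fin 0, ∑ a, ∑ b, ‖L' (i, j) a b‖ ^ 2 = α)) := by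
  refine ⟨1, L, ?_, 1, one_pos, ?_, ?_, fun i => i.elim0, fun j => j.elim0⟩
  · have hper : perPoly (Fin 0) ℂ = 1 := Matrix.permanent_isEmpty
    have hM : (Matrix.of fun a b => MvPolynomial.C ((1 : Matrix (Fin m) (Fin m) ℂ) a b) +
        ∑ v : Fin 0 × Fin 0, MvPolynomial.C (L v a b) * MvPolynomial.X v) =
        (MvPolynomial.C : ℂ →+* MvPolynomial (Fin 0 × Fin 0) ℂ).mapMatrix 1 := by
      ext a b
      simp
    rw [hper, hM, map_one, Matrix.det_one]
  · simp
  · simp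

end Summit.ValiantsHypothesis.Theorems.ScaledSameSize

namespace Summit.ValiantsHypothesis.Theorems

open Summit.ValiantsHypothesis.Theorems.ScaledSameSize

/-- **`ScaledSameSize` (stmt-ValiantsHypothesis-5320).**  If `(Λ, L)` of size `m` computes
`per_n`, then some `(Λ', L')` of the same size computes `per_n` and is operator-scaled
(`Λ'Λ'ᴴ + Σ L'_v L'_vᴴ = α I = Λ'ᴴΛ' + Σ L'_vᴴ L'_v`) and torus-balanced
(`Σ_j ‖L'_(i,j)‖² = α = Σ_i ‖L'_(i,j)‖²`) with one constant `α > 0`: the norm minimiser of the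
closed fibre `{det = per_n}` (Kempf–Ness first-order condition, `scaled_of_pos`). -/
theorem scaledSameSize_proof :
    Summit.ValiantsHypothesis.ValiantsHypothesis.Theses.ScaledPencil.ScaledSameSize := by
  intro n m Λ L hdet
  rcases Nat.eq_zero_or_pos n with hn | hn
  · subst hn
    exact scaled_of_zero L
  · exact scaled_of_pos hn Λ L hdet

end Summit.ValiantsHypothesis.Theorems
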